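import Mathlib
import HarnessLib
import HarnessLib.Audit
import Summits.AtomisticToContinuum.Statement
import Summits.AtomisticToContinuum.BoseEinsteinCondensation.Theorems.BECInfraredBoundAssembly
import Summits.AtomisticToContinuum.BoseEinsteinCondensation.Theorems.BECCutLineWeakDisorderOccupationStability
import HarnessLib.Audit.Status.Attr

/-!
Route: BECCellInformation

# Route BECCellInformation — BEC as bounded conditional entropy — of the log N nats naming a boson's
cell of fixed side, the other N−1 bosons know O(1); the rest is a cube log-Sobolev inequality paid
in kinetic energy

It suffices to show X = BOUNDED CONDITIONAL ENTROPY DEFICIT (item CondEntropyBound, the target): for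
every repulsive finite-range
radial v there is ρ₀ > 0 such that for 0 < ρ < ρ₀ there is C with: for all large N = n+1 there is δ
> 0 such that every NON-NEGATIVE
δ-near-minimiser Ψ ≥ 0 of the Dirichlet N-body energy in the box Λ of side L = (N/ρ)^(1/3) has E_Y
KL( p(·|Y) ‖ u_Λ ) ≤ C, where
Y = (x₂,…,x_N) ~ its marginal m(Y)dY under Ψ², p(·|Y) = Ψ(·,Y)²/m(Y) is the law of one boson given
all the others and u_Λ the uniform
law on Λ — the conditional differential entropy h(x₁ | x₂…x_N) stays within C nats of log|Λ|
uniformly in N. Realises idea card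
renyi-entropic-delocalisation (spine; gen-2 conforming re-plan of the retired not-a-thesis route
BECConditionalEntropy, whose assembly
ended at the Literature constant): X ⇒ ⟨φ₀,γφ₀⟩ ≥ e^(−C)N for positive near-ground states by the
Rényi-½ identity + Jensen, ⇒ the
zero-mode frame X_B1 by phase rigidity, ⇒ the conjunct by the PROVED bec_of_zeroMode; and X itself
splits EXACTLY (KL chain rule over
cells of a fixed side l) into a coarse MUTUAL INFORMATION I(cell_l(x₁); Y) (crux 2), a one-body
profile entropy KL(P¹‖u_Λ) (crux 3)
and a within-cell term that the logarithmic Sobolev inequality on cubes of side l bounds by c₀l² ×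
(kinetic energy per particle) = O(1).
Typed junk-free as lower Lebesgue integrals of Mathlib's InformationTheory.klFun (t log t + 1 − t ≥
0), X = (x, Y) split by
Matrix.vecCons exactly as in BoseGas.occupation; positivity encoded as Ψ.ψ X = ‖Ψ.ψ X‖.
Lean: `∀ v : ℝ → ENNReal,
Literature.MathematicalPhysics.QuantumManyBody.BoseGas.IsRepulsiveFiniteRange v → ∃ ρ₀ : ℝ, 0 < ρ₀ ∧
∀ ρ : ℝ, 0 < ρ → ρ < ρ₀ → ∃ C : ℝ, ∀ᶠ n : ℕ in Filter.atTop, ∃ δ : ENNReal, 0 < δ ∧ ∀ Ψ :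
Literature.MathematicalPhysics.QuantumManyBody.BoseGas.TrialState (n + 1)
(Literature.MathematicalPhysics.QuantumManyBody.BoseGas.sideLength ρ (n + 1)),
Literature.MathematicalPhysics.QuantumManyBody.BoseGas.energy v Ψ ≤
Literature.MathematicalPhysics.QuantumManyBody.BoseGas.groundStateEnergy v (n + 1)
(Literature.MathematicalPhysics.QuantumManyBody.BoseGas.sideLength ρ (n + 1)) + δ → (∀ X, Ψ.ψ X =
(‖Ψ.ψ X‖ : ℂ)) → ∫⁻ Y : Literature.MathematicalPhysics.QuantumManyBody.BoseGas.Config n, ∫⁻ x in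
Literature.MathematicalPhysics.QuantumManyBody.BoseGas.box
(Literature.MathematicalPhysics.QuantumManyBody.BoseGas.sideLength ρ (n + 1)), ENNReal.ofReal ((∫ z,
‖Ψ.ψ (Matrix.vecCons z Y)‖ ^ 2) / Literature.MathematicalPhysics.QuantumManyBody.BoseGas.sideLength
ρ (n + 1) ^ 3 * InformationTheory.klFun
(Literature.MathematicalPhysics.QuantumManyBody.BoseGas.sideLength ρ (n + 1) ^ 3 * ‖Ψ.ψ
(Matrix.vecCons x Y)‖ ^ 2 / ∫ z, ‖Ψ.ψ (Matrix.vecCons z Y)‖ ^ 2)) ≤ ENNReal.ofReal C`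

## Assembly
Pure composition plus ONE proved theorem of the tree, certified sorry-free in Sketch.lean (axioms
propext / Classical.choice / Quot.sound) and
shipped as glue.lean: `theorem closes (hA : CellInformationBound) (hB : OneBodyEntropyBound) (hR :
GroundStateRigidity) (hCR : CoarseChainRule)
(hE : EnergyPerParticleBound) (hT : TwoScaleReduction) (hJ : EntropicZeroMode) (hNN :
NonnegNearMinimiser) (hO : OccupationStability)
(hZ : ZeroModeTransfer) : _root_.BoseEinsteinCondensation :=
AtomisticToContinuum.BECInfraredBound.bec_of_zeroMode (hZ hE hNN hR hO (hJ (hT hE (hCR hA hB))))`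
— cruxes 2+3 give the coarse bound (CoarseChainRule), the energy bound and the cube LSI give X
(TwoScaleReduction), X gives the zero-mode
bound for non-negative near-minimisers (EntropicZeroMode), the frame (NonnegNearMinimiser,
GroundStateRigidity, OccupationStability) transfers
it to all near-minimisers = X_B1 (ZeroModeTransfer), and bec_of_zeroMode
(Theorems/BECInfraredBoundAssembly.lean, imported) gives the
conjunct `_root_.BoseEinsteinCondensation` (the audited sub-problem abbrev; = the Literature
constant by rfl). The target CondEntropyBound is
the node between TwoScaleReduction and EntropicZeroMode and is not a hypothesis of `closes`.

Rationale: WHY THIS LINE. Positivity of the ground state turns condensation into an information statement: for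
Ψ ≥ 0 the EXACT identity ⟨φ₀,γ_Ψφ₀⟩/N =
E_Y exp(−D_½(p(·|Y)‖u_Λ)) (φ₀ = L^(−3/2)1_Λ, D_½ = Rényi-½ divergence; Reatto's test-particle
formula for Jastrow states, Reatto1969,
PenroseOnsager1956) with Jensen and D_½ ≤ KL gives ⟨φ₀,γφ₀⟩ ≥ e^(−C)N from X, and the shared
refuter-checked frame (GroundStateRigidity =
stmt-9072, OccupationStability = stmt-9074, the PROVED
AtomisticToContinuum.BECInfraredBound.bec_of_zeroMode) carries this to the conjunct.
Imported: information theory (KL chain rule, data processing, TV-continuity of finite-alphabet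
mutual information, finite de Finetti MI bounds
GavalakisKontoyiannis2021 / DiaconisFreedman1987, CoverThomas2005), functional inequalities
(logarithmic Sobolev inequality for Lebesgue
measure on a cube, constant c₀s², Weissler1980 / Ledoux2001 / BakryGentilLedoux2014, in the
two-scale architecture of GrunewaldEtAl2009), and
the Lieb–Yngvason cell energetics PROVED in the tree (LSSY2005_boxLowerBound_holds,
LSSY2005_lowerBound_dirichlet_holds,
eventually_groundStateEnergy_le_dyson) for the profile crux. The chain rule is what no other
positivity functional of this sub has
(participation ratio E[e^(D_½)] = BECCutLineWeakDisorder's LandscapeBound, Palm affinities of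
BECLiebAntibunching / BECRieszShadow, χ², swap
purity): it splits scales EXACTLY, so the kinetic gap is paid only inside N-independent cells (cost
c₀l²·4πρa(1+o(1)) = O((l/ξ)²),
ξ = (ρa)^(−1/2)) and what is left is one number with a meaning — the mutual information between the
INDEX OF THE CELL holding one boson
(M³ = N/(ρl³) letters, trivially ≤ log M³ ≍ log N) and the other N−1 bosons: condensation of a
positive state IS "O(1) of those log N nats".
Versus gen-0 (retired BECConditionalEntropy): the rank-2 crux is the COARSE MI (weaker by data
processing than the fine I(x₁;Y) of
ex-stmt-3594, TV-continuous at fixed N so the ∀-near-minimiser quantifier is honest, free of the a/r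
correlation hole, which energy pays
instead), the profile crux is the cell-free KL(P¹‖u_Λ) without positivity, the transfer is atomised
over shared stamped items, and the route
DECIDES the sub-problem (`closes : … → _root_.BoseEinsteinCondensation`, sorry-free). This is exit
(b′) "positivity + genuinely
three-dimensional input" of Literature.Barriers.AtomisticToContinuum.KineticGapLengthScalesNarrow:
crux 2's heuristic value ½σ_l²,
σ_l² = ρ∫|φ̂_eff|²|ĝ_l|²S(k)d³k/(2π)³, is infrared-finite exactly when d ≥ 2 (S(k) ~ k,
Reatto–Chester tail φ_eff ~ 1/r², ReattoChester1967)
and log-divergent in d = 1 (Lenard1964).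

RANKED CRUXES. #0 CondEntropyBound (target) — X of § Thesis (verbatim the gen-0 target
ex-stmt-AtomisticToContinuum-3587): mean conditional relative entropy E_Y KL(p(·|Y)‖u_Λ) ≤ C for all
non-negative δ-near-minimisers (δ chosen after N), all 0 < ρ < ρ₀(v), uniformly in N; reached from
cruxes 2+3 by CoarseChainRule and TwoScaleReduction, consumed by EntropicZeroMode. (why it might
fail: Only through its parts: log N growth of the coarse mutual information (crux 2) or a one-body
pile-up on a vanishing volume fraction (crux 3); needles are excluded since δ is chosen after N and
entropy ≤ c₀L²×Fisher information (LSI) at fixed N.) [LSSY2005, CoverThomas2005, GrunewaldEtAl2009,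
Reatto1969]
#2 CellInformationBound (crux) — COARSE MUTUAL INFORMATION BOUND (the card's crux, typed): for every
repulsive finite-range v there is ρ₀ > 0 such that for 0 < ρ < ρ₀ there are a cell side l > 0 and C
with: for all large N = n+1 there is δ > 0 such that every non-negative δ-near-minimiser Ψ of the
Dirichlet energy (L = (N/ρ)^(1/3)) has I( cell_l(x₁) ; (x₂,…,x_N) ) ≤ C, where cell_l(x₁) ∈ (Fin 3 →
Fin M), M = ⌈L/l⌉, indexes the congruent half-open sub-cube of side L/M ≤ l containing x₁. Typed as
∫_Y Σ_k m(Y)·P_l(k)·klFun( A_k(Y)/(m(Y)P_l(k)) ) dY ≤ C with A_k(Y) = ∫_(cell k) Ψ(x,Y)²dx, m(Y) =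
Σ_k A_k(Y) = ∫Ψ(z,Y)²dz, P_l(k) = ∫A_k dY = P(x₁ ∈ cell k) (pointwise in Y this integrand IS Σ_k A_k
log(A_k/(mP_l(k))), since Σ_k(mP_k − A_k) = 0). Trivially I ≤ log M³ = log(N/(ρl³)); the claim is
O(1) ('of the log N nats naming a boson's cell, all other bosons together know O(1)'). Expected
½σ_l², σ_l² = ρ∫|φ̂_eff|²|ĝ_l|²S d³k/(2π)³ = O(√(ρa³)) + O((ξ/l)²) (Bogoliubov / Reatto–Chester);
free gas I = 0. Finite alphabet ⇒ continuous in total variation of |Ψ|² at fixed N, so the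
∀-near-minimiser form follows from the bound for Ψ₀ + rigidity: the crux is the N-uniform bound for
Ψ₀. [difficulty: open-problem] (why it might fail: Needs O(1) LONG-RANGE information in |Ψ₀|²: false
under number rigidity / incipient solid (d=1 Tonks: I ≍ log N, λ_max ~ √N); the value ½σ_l² is
Bogoliubov–Jastrow heuristics (S(k)~k, 1/r² tail) with no non-perturbative control of log Ψ₀ at
fixed ρa³.) [Reatto1969, ReattoChester1967, GavalakisKontoyiannis2021, DiaconisFreedman1987,
CoverThomas2005, Lenard1964, GhoshPeres2017, doi:10.1007/s10955-017-1820-0, Rougerie2014]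
#3 OneBodyEntropyBound (crux) — ONE-BODY PROFILE ENTROPY BOUND (cell-free replacement of gen-0's
ProfileEntropyBound ex-stmt-3595; no positivity hypothesis): for every repulsive finite-range v
there is ρ₀ > 0 such that for 0 < ρ < ρ₀ there is C with: for all large N = n+1 there is δ > 0 such
that every δ-near-minimiser Ψ (complex allowed) has KL(P¹ ‖ u_Λ) ≤ C, P¹(x) = ∫|Ψ(x,Y)|²dY the
one-body law; typed ∫_(x∈Λ) L⁻³·klFun(L³P¹(x)) dx ≤ C (= KL since ∫_Λ P¹ = 1). Expected proof (the
foreseen split): coarse part KL(P_l‖ū_l) ≤ log(1+χ²) = O(1) by the Lieb–Yngvason cell method applied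
to the STATE's occupation law (energy(Ψ) ≥ E_Ψ Σ_cells E₀^Neu(n_c,l); tree:
LSSY2005_boxLowerBound_holds, LSSY2005_cellDecomposition) against energy ≤ KN+δ
(eventually_groundStateEnergy_le_dyson): M³Σ_kP_l(k)² = O(1) at fixed ρ for l ≳ max(ρ^(−1/3),
aY^(−6/17)); fine part Σ_k P_l(k)KL(P¹_k‖u_k) ≤ c₀(L/M)²∫|∇√P¹|² ≤ c₀l²(K + δ/N) by the cube LSI and
convexity of Fisher information under Y-averaging. Free Dirichlet gas: KL(P¹‖u) = 3(1 − log 2) ≈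
0.92. [difficulty: M] (why it might fail: A fixed fraction of bosons in a vanishing volume fraction
(wall/corner layer of fixed width: KL ≍ (f/3)log N) must be excluded for ALL δ-near-minimisers by an
LY cell lower bound on the state's occupation law + cube LSI, uniform-in-N Dirichlet bookkeeping
never written.) [LiebYngvason1998, LSSY2005, Ledoux2001, BakryGentilLedoux2014, GrunewaldEtAl2009,
Literature.MathematicalPhysics.QuantumManyBody.BoseGas.LSSY2005_boxLowerBound,
Literature.MathematicalPhysics.QuantumManyBody.BoseGas.eventually_groundStateEnergy_le_dyson]
#4 GroundStateRigidity (crux) — PHASE RIGIDITY BELOW THE FINITE-N GAP — verbatim the signature of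
stmt-AtomisticToContinuum-9072 (shared by design with the open routes BECCutLineWeakDisorder r4 and
BECClassicalWindow r4; refuter-checked 14:31Z, grounded 16:19Z): for every repulsive finite-range v,
all small ρ, all large N and every η > 0 there is δ > 0 such that any two δ-near-minimisers Ψ, Φ of
the Dirichlet energy (L = (N/ρ)^(1/3)) satisfy ∫|Ψ − cΦ|² ≤ η for some unit complex c. Content:
compact resolvent, unique positive ground state and gap at fixed N (positivity-improving Dirichlet
semigroup for finite v, ReedSimonIV1978 XIII.12/47; tree:
IsPositivityImproving.simple_top_eigenvalue, fact GroundStateFeynmanKac); for ⊤-valued v via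
uniqueness of the energy-minimising dilute component. Used only through ZeroModeTransfer.
[difficulty: M] (why it might fail: ⊤-valued v (hard cores, hollow shells) are admissible: the free
configuration set may disconnect; unless the dilute component is the UNIQUE energy-minimising one
for all large N at ρ < ρ₀ the Dirichlet ground space degenerates and no δ pins the phase —
unproved.) [ReedSimonIV1978, Simon1982, Kahle2012, BaryshnikovBubenikKahle2013, LSSY2005,
stmt-AtomisticToContinuum-9072]
#9 CoarseChainRule (support) — CellInformationBound → OneBodyEntropyBound → COARSE CONDITIONAL
ENTROPY BOUND at the scale l of crux 2: E_Y KL(Q_l(·|Y) ‖ ū_l) ≤ C′, Q_l(k|Y) = A_k(Y)/m(Y) = P(x₁ ∈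
cell k | Y), typed ∫_Y Σ_k m(Y)M⁻³klFun(M³A_k(Y)/m(Y)) dY ≤ C′ (gen-0's coarse form). Proof:
pointwise in Y, Σ_k mM⁻³klFun(M³A_k/m) = Σ_k A_k log(M³A_k/m) (Σ_kA_k = m: cells tile [0,L)³ ⊇ Λ, Ψ
= 0 off Λ) = [Σ_k A_k log(A_k/(mP_l(k)))] + [Σ_k A_k log(M³P_l(k))]; the first bracket is crux 2's
integrand; ∫dY of the positive part of the second is ≤ KL(P_l‖ū_l) + e⁻¹ ≤ KL(P¹‖u_Λ) + e⁻¹ ≤ C_B +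
1 (log-sum inequality per cell); C′ = C_A + C_B + 1, l := l_A, δ := min, ρ₀ := min. Lean effort M
(Fubini over Config n × cells, finite sums, klFun junk values at 0). [deps: CellInformationBound,
OneBodyEntropyBound] [difficulty: provable-now] [CoverThomas2005, GrunewaldEtAl2009, Csiszar1975]
#9 EnergyPerParticleBound (support) — ENERGY PER PARTICLE BOUNDED at small density (verbatim gen-0
ex-stmt-3600): for every repulsive finite-range v there is ρ₀ > 0 such that for 0 < ρ < ρ₀ there is
K with E₀(N,(N/ρ)^(1/3)) ≤ K·N for all large N. Now one line from the tree:
Literature…BoseGas.eventually_groundStateEnergy_le_dyson (PROVED: E₀ ≤ 4πρa(1+C(ρa³)^(1/3))N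
eventually, for 0 < a < ∞) and, for scattering length 0 or in general,
groundStateEnergy_le_of_separated_cubes / the symmetrised disjoint-bump state (interaction 0, ⊤·0 =
0). Only boundedness is used (TwoScaleReduction's local term, ZeroModeTransfer's E₀ < ⊤).
[difficulty: provable-now] [LSSY2005, Dyson1957,
Literature.MathematicalPhysics.QuantumManyBody.BoseGas.eventually_groundStateEnergy_le_dyson]
#9 TwoScaleReduction (support) — EnergyPerParticleBound → (coarse conditional entropy bound at some
scale l, the conclusion of CoarseChainRule) → CondEntropyBound. Exact KL chain rule over the cell
partition for each Y: KL(p(·|Y)‖u_Λ) = KL(Q_l(·|Y)‖ū_l) + Σ_k Q_l(k|Y)·KL(p_k(·|Y)‖u_k); the local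
term is Σ_k Q_k Ent_(u_k)(f_k) ≤ c₀(L/M)²∫_Λ|∇_x√p(x|Y)|²dx by the logarithmic Sobolev inequality
for Lebesgue measure on a cube of side s = L/M ≤ l (constant c₀s²: Weissler1980 circle LSI + even
reflection + tensorisation), with √p = |Ψ(·,Y)|/√m(Y), ∫|∇√p|² ≤ ∫|∇_xΨ(x,Y)|²dx/m(Y); its
m(Y)dY-average is c₀s²·T(Ψ)/N (Bose symmetry) ≤ c₀l²(K + δ/N) as T ≤ energy ≤ KN + δ; choose δ :=
min(δ_coarse, 1), C := C′ + c₀l²(max K 0 + 1); shift the atTop filter N = n+1. A theorem on paper; L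
in Lean (cube LSI not in Mathlib; one helper shared with crux 3's split). [deps:
EnergyPerParticleBound, CoarseChainRule] [difficulty: L] [Weissler1980, Ledoux2001,
BakryGentilLedoux2014, GrunewaldEtAl2009, OttoVillani2000, LSSY2005]
#9 EntropicZeroMode (support) — CondEntropyBound → ZERO-MODE OCCUPATION ≥ cN FOR NON-NEGATIVE
NEAR-MINIMISERS (∀v ∃ρ₀ ∀ρ<ρ₀ ∃c>0 ∀ᶠN ∃δ>0 ∀Ψ δ-near-min, Ψ ≥ 0 → ofReal(cN) ≤ occupation N φ₀ Ψ,
φ₀ = L^(−3/2)·1_Λ; the conclusion is X_B1's body with the positivity hypothesis added). Rényi-½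
identity: for Ψ ≥ 0, occupation N φ₀ Ψ / N = L⁻³∫(∫Ψ(x,Y)dx)²dY = E_(m dY) exp(−D_½(p(·|Y)‖u_Λ));
Jensen for exp(−·) under the probability law m(Y)dY and D_½ = −2log∫√(pu) ≤ KL (concavity of log)
give occupation ≥ exp(−max(C,0))·N (c absorbs C < 0: lesson of BECSwapAffinitySwapJensen_refuted);
index shift N = n+1. Lean effort M (Jensen for lintegral/exp; occupation unfolds by rfl on n+1).
[deps: CondEntropyBound] [difficulty: provable-now] [Reatto1969, PenroseOnsager1956, LSSY2005,
CoverThomas2005]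
#9 NonnegNearMinimiser (support) — NON-NEGATIVE NEAR-MINIMISERS EXIST (diamagnetic smoothing; new,
frame lemma usable by every positivity route): for all v, N, L with E₀(N,L) ≠ ⊤ and every δ > 0
there is a δ-near-minimiser Ψ ∈ TrialState N L with Ψ = |Ψ| pointwise. Proof: Φ with energy ≤ E₀ +
δ/2; f_ε := √(|Φ|²+ε²) − ε is C¹, vanishes exactly where Φ does (off Λ^N; a.e. on hard cores),
symmetric, 0 ≤ f_ε ≤ |Φ|, |∇f_ε| = |Re(Φ̄∇Φ)|/√(|Φ|²+ε²) ≤ |∇Φ|; so energy(f_ε/‖f_ε‖₂) ≤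
energy(Φ)/‖f_ε‖₂² and ‖f_ε‖₂ ↑ 1 as ε ↓ 0, giving energy ≤ E₀ + δ for ε small. Degenerate regimes
checked: N = 0 (Config 0 is a point, Ψ ≡ 1), L ≤ 0 < N (TrialState empty ⇒ E₀ = ⊤, hypothesis
false), δ = ⊤ trivial. Lean effort M (smoothed TrialState; ContDiff of sqrt off 0; monotone
convergence). [difficulty: provable-now] [ReedSimonIV1978, LiebLoss2001, LSSY2005]
#9 OccupationStability (support) — OCCUPATION STABILITY — verbatim the signature of
stmt-AtomisticToContinuum-9074 (shared with BECCutLineWeakDisorder / BECClassicalWindow;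
refuter-checked, grounded provable-now): for a normalised measurable mode u, trial states Ψ, Φ ∈
TrialState (n+1) L and |c| = 1: occ(u,Ψ)^(1/2) ≤ occ(u,Φ)^(1/2) + (n+1)^(1/2)·‖Ψ − cΦ‖₂ (Minkowski
in L²(dY) + Cauchy–Schwarz in x; occ(cΦ) = occ(Φ)). [difficulty: provable-now] [LSSY2005,
stmt-AtomisticToContinuum-9074]
#9 ZeroModeTransfer (support) — GLUE TO THE PROVED FRAME (bookkeeping): EnergyPerParticleBound →
NonnegNearMinimiser → GroundStateRigidity → OccupationStability → (zero-mode bound for non-negative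
near-minimisers, EntropicZeroMode's conclusion) → X_B1, where X_B1 is VERBATIM the hypothesis of the
proved theorem AtomisticToContinuum.BECInfraredBound.bec_of_zeroMode (= BECInfraredBound's zero-mode
thesis ex-stmt-0686: ∀v ∃ρ₀ ∀ρ<ρ₀ ∃c>0 ∀ᶠN ∃δ>0 ∀ δ-near-minimisers Ψ: ofReal(cN) ≤ occupation N φ₀
Ψ). Proof: ρ₀ := min; c′ := c/4; eventually in N: δ₁ (zero-mode hyp.), δ₂ (rigidity at η := c/4), δ
:= min δ₁ δ₂; E₀ ≤ KN < ⊤ so NonnegNearMinimiser gives a non-negative δ-near-minimiser Ψ with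
occ(φ₀,Ψ) ≥ cN; for any δ-near-minimiser Φ rigidity gives ‖Ψ − c̃Φ‖₂² ≤ c/4 and OccupationStability
(u = φ₀, measurable + normalised for L > 0: tree lemmas aestronglyMeasurable_constMode,
lintegral_constMode_sq) gives occ(φ₀,Φ)^(1/2) ≥ (cN)^(1/2) − (Nc/4)^(1/2) = ½(cN)^(1/2), i.e. occ ≥
cN/4. Lean effort M (ENNReal rpow ½ arithmetic, filter bookkeeping). [deps: EnergyPerParticleBound,
NonnegNearMinimiser, GroundStateRigidity, OccupationStability, EntropicZeroMode] [difficulty: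
provable-now] [LSSY2005, PenroseOnsager1956,
Summits.AtomisticToContinuum.BoseEinsteinCondensation.Theorems.BECInfraredBoundAssembly]

TWO-LAYER PLAN. Foreseen glued splits (nothing filed now; k ≤ 3, depth 1): CellInformationBound ⇐
InsertionFieldCellVariance (E_Y of the empirical
relative variance across cells of the cell-integrated conditional intensity Λ_k(Y) = ∫_(cell
k)Ψ₀(x,Y)²dx is ≤ C: a point-process statement
on |Ψ₀|², heuristically ½σ_l²) → VarianceToInformation (KL ≤ log(1+χ²) per Y, plus the TV-continuity
transfer from Ψ₀ to δ-near-minimisers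
at fixed N) → CellInformationBound. OneBodyEntropyBound ⇐ CellProfileChiSquare (LY cell method on
the state's occupation law:
M³Σ_kP_l(k)² ≤ C for l above the LY scale) → WithinCellLSI (cube LSI + Fisher convexity + energy:
Σ_kP_l(k)KL(P¹_k‖u_k) ≤ c₀l²(K+1)) →
OneBodyEntropyBound (the cube-LSI lemma is shared with TwoScaleReduction: one Theorems helper,
`--supports` both). GroundStateRigidity ⇐
UniqueGappedGroundState (Rellich + Perron–Frobenius for the Dirichlet H_N; hard-sphere
dilute-component uniqueness at small ρ) → GapPinsPhase
→ GroundStateRigidity, to be coordinated with the tenure planners of BECCutLineWeakDisorder /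
BECClassicalWindow (one split, shared item).

KILL CRITERIA. ¬CellInformationBound for some admissible v at arbitrarily small ρ (I(cell_l(x₁);Y) ≥
c·log N along non-negative near-minimisers for
every fixed l) closes the route (close --reason refuted:CellInformationBound) and is itself news: a
positive three-dimensional dilute ground
state whose particles carry long-range information about each other's coarse positions (1-D-type
rigidity). ¬OneBodyEntropyBound (a wall
pile-up surviving the LY cell bound) forces a pivot to an inner box Λ′ = (εL,(1−ε)L)³ for the
reference law (as BECInfraredBound's inner-box
items), not a close. ¬GroundStateRigidity (degenerate / non-positive Dirichlet ground spaces for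
⊤-valued v at small ρ) breaks this route
together with BECCutLineWeakDisorder and BECClassicalWindow: pivot = restate for v finite a.e.
(positivity-improving case) or add the
dilute-component hypothesis. A refutation of a support (all are theorems on paper) can only be
`misstated` ⇒ repaired item + re-certified
glue. X_B1-type zero-mode theses refuted elsewhere would kill the frame of all Dirichlet positivity
routes at once. LandscapeBound
(BECCutLineWeakDisorder) or PalmAffinityBound (BECLiebAntibunching/BECRieszShadow) proved first
moots this route (same conclusion, other
functional); CellInformationBound proved first moots theirs only after OneBodyEntropyBound.

NOT DECOMPOSED YET. The proof technology of crux 2 — how to bound the long-range information in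
|Ψ₀|² without solving the problem: variance of the
cell-integrated conditional intensity via the convex variational characterisation of Ψ₀² (unique
minimiser of P ↦ ∫|∇√P|² + ∫VP on
symmetric densities), exchangeability / finite de Finetti MI bounds (GavalakisKontoyiannis2021: I
between one coordinate and the empirical
field), strong data-processing constants for the 'resample one boson' channel (PolyanskiyWu2017), or
non-rigidity of the ground-state point
process (GhoshPeres2017 class) — is deliberately not split at open. Also not decomposed: the
spectral package behind crux 4 (shared), the
LY occupation-law bookkeeping and the cube-LSI constant behind crux 3 and TwoScaleReduction, the
optimal l (any FIXED l works for
boundedness; l ~ ξ = (ρa)^(−1/2) balances the two scales with sharp constants), inner-box and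
periodic variants, positive temperature.
All are layer-2 children, filed by glued splits after a crux moves (D-0019).

CHEAPEST FALSIFIER. (i) By hand, Gaussian/Bogoliubov closed form (d = 3 vs d = 1): in the Bogoliubov
ground state the density field is Gaussian with
S(k) = k/√(k²+16πρa); the coarse MI is ½σ_l² + O(σ_l⁴) with σ_l² = ρ∫|φ̂_eff|²|ĝ_l|²S d³k/(2π)³,
φ̂_eff(k) ≈ 8πa/(k²+ξ⁻²)-type: FINITE and
N-independent in d = 3 (≈ C√(ρa³) + C′(ξ/l)²), while the d = 1 analogue grows like log L — a refuter
recomputing σ_l² and finding log L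
growth in d = 3 kills crux 2 at once (and must find log L in d = 1: built-in consistency with
PitaevskiiStringariOneDimension / Lenard's √N).
(ii) v ≡ 0 sanity (done by hand here): Ψ₀ = ∏φ_D, p(·|Y) = φ_D² is Y-independent ⇒ I = 0; KL(P¹‖u) =
3∫₀¹2sin²(πt)log(2sin²(πt))dt =
3(1 − log 2) ≈ 0.921; X holds with C ≈ 0.921 and gives ⟨φ₀,γφ₀⟩/N ≥ e^(−0.921) ≈ 0.40 against the
true (8/π²)³ ≈ 0.533 — consistent, not
sharp. (iii) kit (not run: compute-free hub, one-shot planning unit): VMC on the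
McMillan/Reatto–Chester hard-sphere Jastrow state,
N = 64…512 at ρa³ = 10⁻³, plug-in (Kozachenko–Leonenko / binning) estimate of I(cell_l(x₁);Y) at l =
ξ: flat in N or ∝ log N?

NUMBERS. Depletion scale √(ρa³) (Bogoliubov/LHY); e₀ ≤ 4πρa(1 + C(ρa³)^(1/3)) (LSSY Thm 2.2; tree:
eventually_groundStateEnergy_le_dyson); LY lower
bound needs L/a > C′Y^(−6/17), Y = 4πρa³/3 (cell scale of crux 3; tree:
LSSY2005_lowerBound_dirichlet_holds); ξ = (8πρa)^(−1/2); trivial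
ceiling of crux 2: log M³ = log(N/(ρl³)); cube Poincaré/LSI constants ∝ s²; free Dirichlet gas:
zero-mode fraction (8/π²)³ ≈ 0.533, profile
entropy 3(1 − log 2) ≈ 0.921, I = 0; 1-D hard core λ_max ~ √N (Lenard1964), I(cell;Y) ≍ log N;
energy-window barrier: window > 4π²M²N/L²
certifies c ≤ 1/(M+1) (δ here is chosen after N). Items at open: 12 (3 cruxes; 9072, 9074 shared and
stamped).

DEFINITION REQUESTS. None filed: everything is typed over
Literature.MathematicalPhysics.QuantumManyBody.BoseGas.{TrialState, energy, groundStateEnergy,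
occupation,
box, sideLength, Config, Space, IsRepulsiveFiniteRange}, Mathlib's InformationTheory.klFun,
Matrix.vecCons, Nat.ceil, Set.Ico and
_root_.BoseEinsteinCondensation; one import beyond the Statement:
Summits.AtomisticToContinuum.BoseEinsteinCondensation.Theorems.BECInfraredBoundAssembly
(bec_of_zeroMode in `closes`, as BECCutLineWeakDisorder / BECClassicalWindow /
BECStoquasticCensoring). A Literature notion of conditional
mutual information of an N-body density would shorten cruxes 0/2/3 — requested only if a second
route wants the same functionals.

Novelty: Searches (2026-08-15, this seat; local searchd timed out once, graph re-rank socket reset once —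
recorded): `lit frontier AtomisticToContinuum --since 2022`
(21 rows; BEC descendants arXiv:2510.20493 kinetic localisation via Poincaré-type inequalities,
arXiv:2603.20776 Neumann-localisation
propagation of condensation, arXiv:2605.06844 trial states — all energy-window / energy); `lit
bridges AtomisticToContinuum --cross any` (no
entropy or information bridge among 30); `lit galaxy search "conditional entropy Bose-Einstein
condensation" --star all` (0/0/0);
`lit galaxy search --star pdf --mode intelligent "<BEC criterion via relative entropy / MI of one
particle given the others; LSI at the healing length>"`
(12: nearest Rougerie 2020 EMS survey hal-02468885 = arXiv:2002.02678, OWR 41/2019, Roy et al. PRA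
97 043625 many-body entropy diagnostics —
numerics); `lit vsearch "<MI between one particle and the rest bounded uniformly in N implies BEC>"`
(10 textbook hits only: Di Castro–Raimondi,
Pethick–Smith, …); `lit search --source crossref "entropy chaos Bose-Einstein condensation Kac chaos
ground state Ugolini"` (doi:10.1007/s10955-017-1820-0
Albeverio–De Vecchi–Ugolini 2017, doi:10.31390/cosa.8.4.06 De Vecchi–Ugolini 2014,
doi:10.31390/cosa.6.4.05 Ugolini 2012,
doi:10.1142/s0219493720500318 ADRU 2019); plus the gen-0 record (zbMATH/Crossref: GrunewaldEtAl2009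
two-scale LSI doi:10.1214/07-aihp200,
Reatto1969 doi:10.1103/physrev.183.334, GavalakisKontoyiannis2021 doi:10.1214/21-ec  [refs: 10.1007/s10955-017-1820-0, 10.31390/cosa.8.4.06, 10.31390/cosa.6.4.05, 10.1142/s0219493720500318, 10.1214/07-aihp200, 10.1103/physrev.183.334, 10.1214/21-ecp428, 2510.20493, 2603.20776, 2605.06844, 2002.02678, 1409.1182, doi:10.1007/s10955-017-1820-0, doi:10.31390/cosa.8.4.06, doi:10.31390/cosa.6.4.05, doi:10.1142/s0219493720500318, doi:10.1214/07-aihp200, doi:10.1103/physrev.183.334, doi:10.1214/]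

Barriers (technique_class: information-inequality log-sobolev positivity two-scale): - technique_class: information-inequality log-sobolev positivity two-scale
- Literature.Barriers.AtomisticToContinuum.KineticGapLengthScales: evaded — the Poincaré/log-Sobolev
constant is paid only on cells of FIXED side l (cost c₀l² × energy per particle = O(1) uniformly in
N), never on Λ_L (where it is ∝ L² = the barrier); the large scales are an information bound, not a
gap.
- Literature.Barriers.AtomisticToContinuum.KineticGapLengthScalesNarrow: evaded by construction —
conjunct (3) (energyWindow_fraction_le) defeats every ENERGY-WINDOW criterion with window ≥ 4π²N/L²;
here δ is chosen AFTER N (below the finite-N gap, made honest by the shared crux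
GroundStateRigidity) and the state input is positivity Ψ ≥ 0, the entry's own open exit (b′); its
caveat "positivity can only be an exit through genuinely three-dimensional input" is met by crux 2,
whose heuristic value ½σ_l² is infrared-finite exactly when d ≥ 2.
- Literature.Barriers.AtomisticToContinuum.PitaevskiiStringariOneDimension: consistent, not evaded —
in d = 1 the same functional diverges (I(cell;Y) ≍ log N for impenetrable bosons, λ_max ~ √N), so
the mechanism is dimension-sensitive through the infrared summability of S(k)|φ̂_eff|².
- Literature.Barriers.AtomisticToContinuum.OneDimensionalHardCore: as above — the Girardeau/Lenard
witness is reproduced by the functional (Tonks gas is number-rigid: the cell of x₁ is pinned by its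
neighbours), not contradicted; all items are typed in d = 3 only.
- Literature.Barriers.

sub-problem: BoseEinsteinCondensation · status: open · opened planner-plancard-AtomisticToContinuum-BoseEin-7481a7ec-g2-0 2026-08-15T19:01:44Z · rev 2 · ledger route-AtomisticToContinuum-BECCellInformation
GENERATED by the gate from the ledger (D-0016/17). Provers cite these decls: `theorem foo : Summit.AtomisticToContinuum.BoseEinsteinCondensation.Theses.BECCellInformation.<Decl> := …` in Summits/AtomisticToContinuum/BoseEinsteinCondensation/Theorems/<Name>.lean.
-/

namespace Summit.AtomisticToContinuum.BoseEinsteinCondensation.Theses.BECCellInformation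

open scoped BigOperators Topology Manifold Classical MeasureTheory ProbabilityTheory Matrix InnerProductSpace ComplexConjugate ContinuousMap
open Filter Set Function TopologicalSpace MeasureTheory

attribute [summit_statement] _root_.BoseEinsteinCondensation

/-- item stmt-AtomisticToContinuum-13438 · target · rank 0 · open · by planner
why it might fail: Only via its parts: log N growth of the coarse MI at every fixed cell side (crux 2: number rigidity of |Ψ₀|²), or N-divergent one-body entropy (crux 3: mass at diverging density, not excluded by LY's linear overfull-cell bound); at fixed N all is finite (δ after N, LSI on Λ_L).
sources: LSSY2005, CoverThomas2005, GrunewaldEtAl2009, Reatto1969, GhoshLebowitz2017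
[target] X of § Thesis (verbatim the gen-0 target ex-stmt-AtomisticToContinuum-3587): mean
conditional relative entropy E_Y KL(p(·|Y)‖u_Λ) ≤ C for all non-negative δ-near-minimisers (δ chosen
after N), all 0 < ρ < ρ₀(v), uniformly in N; reached from cruxes 2+3 by CoarseChainRule and
TwoScaleReduction, consumed by EntropicZeroMode. -/
@[route_item "route-AtomisticToContinuum-BECCellInformation", crux]
def CondEntropyBound : Prop :=
  ∀ v : ℝ → ENNReal, Literature.MathematicalPhysics.QuantumManyBody.BoseGas.IsRepulsiveFiniteRange v → ∃ ρ₀ : ℝ, 0 < ρ₀ ∧ ∀ ρ : ℝ, 0 < ρ → ρ < ρ₀ → ∃ C : ℝ, ∀ᶠ n : ℕ in Filter.atTop, ∃ δ : ENNReal, 0 < δ ∧ ∀ Ψ : Literature.MathematicalPhysics.QuantumManyBody.BoseGas.TrialState (n + 1) (Literature.MathematicalPhysics.QuantumManyBody.BoseGas.sideLength ρ (n + 1)), Literature.MathematicalPhysics.QuantumManyBody.BoseGas.energy v Ψ ≤ Literature.MathematicalPhysics.QuantumManyBody.BoseGas.groundStateEnergy v (n + 1) (Literature.MathematicalPhysics.QuantumManyBody.BoseGas.sideLength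 ρ (n + 1)) + δ → (∀ X, Ψ.ψ X = (‖Ψ.ψ X‖ : ℂ)) → ∫⁻ Y : Literature.MathematicalPhysics.QuantumManyBody.BoseGas.Config n, ∫⁻ x in Literature.MathematicalPhysics.QuantumManyBody.BoseGas.box (Literature.MathematicalPhysics.QuantumManyBody.BoseGas.sideLength ρ (n + 1)), ENNReal.ofReal ((∫ z, ‖Ψ.ψ (Matrix.vecCons z Y)‖ ^ 2) / Literature.MathematicalPhysics.QuantumManyBody.BoseGas.sideLength ρ (n + 1) ^ 3 * InformationTheory.klFun (Literature.MathematicalPhysics.QuantumManyBody.BoseGas.sideLength ρ (n + 1) ^ 3 * ‖Ψ.ψ (Matrix.vecCons x Y)‖ ^ 2 / ∫ z, ‖Ψ.ψ (Matrix.vecCons z Y)‖ ^ 2)) ≤ ENNReal.ofReal C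

/-- item stmt-AtomisticToContinuum-13439 · crux · rank 2 · open · by planner
why it might fail: Needs O(1) long-range information in |Ψ₀|²: I ≍ log N whenever the ground-state point process is number-rigid at scale l — true in d=1 (Tonks, λ_max~√N) and for d≤2 S(k)~k laws (Ghosh–Peres); d=3 non-rigidity (½σ_l² finite) is Bogoliubov–Jastrow heuristics, unproved at fixed ρa³.
sources: Reatto1969, ReattoChester1967, GhoshPeres2017, GhoshLebowitz2017, Lenard1964, GavalakisKontoyiannis2021
[crux] COARSE MUTUAL INFORMATION BOUND (the card's crux, typed): for every repulsive finite-range v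
there is ρ₀ > 0 such that for 0 < ρ < ρ₀ there are a cell side l > 0 and C with: for all large N =
n+1 there is δ > 0 such that every non-negative δ-near-minimiser Ψ of the Dirichlet energy (L =
(N/ρ)^(1/3)) has I( cell_l(x₁) ; (x₂,…,x_N) ) ≤ C, where cell_l(x₁) ∈ (Fin 3 → Fin M), M = ⌈L/l⌉,
indexes the congruent half-open sub-cube of side L/M ≤ l containing x₁. Typed as ∫_Y Σ_k
m(Y)·P_l(k)·klFun( A_k(Y)/(m(Y)P_l(k)) ) dY ≤ C with A_k(Y) = ∫_(cell k) Ψ(x,Y)²dx, m(Y) = Σ_k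
A_k(Y) = ∫Ψ(z,Y)²dz, P_l(k) = ∫A_k dY = P(x₁ ∈ cell k) (pointwise in Y this integrand IS Σ_k A_k
log(A_k/(mP_l(k))), since Σ_k(mP_k − A_k) = 0). Trivially I ≤ log M³ = log(N/(ρl³)); the claim is
O(1) ('of the log N nats naming a boson's cell, all other bosons together know O(1)'). Expected
½σ_l², σ_l² = ρ∫|φ̂_eff|²|ĝ_l|²S d³k/(2π)³ = O(√(ρa³)) + O((ξ/l)²) (Bogoliubov / Reatto–Chester);
free gas I = 0. Finite alphabet ⇒ continuous in total variation of |Ψ|² at fixed N, so the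
∀-near-minimiser form follows from the bound for Ψ₀ + rigidity: the crux is the N-uniform bound for
Ψ₀. [difficulty: open-problem] -/
@[route_item "route-AtomisticToContinuum-BECCellInformation", crux]
def CellInformationBound : Prop :=
  ∀ v : ℝ → ENNReal, Literature.MathematicalPhysics.QuantumManyBody.BoseGas.IsRepulsiveFiniteRange v → ∃ ρ₀ : ℝ, 0 < ρ₀ ∧ ∀ ρ : ℝ, 0 < ρ → ρ < ρ₀ → ∃ l : ℝ, 0 < l ∧ ∃ C : ℝ, ∀ᶠ n : ℕ in Filter.atTop, ∃ δ : ENNReal, 0 < δ ∧ ∀ Ψ : Literature.MathematicalPhysics.QuantumManyBody.BoseGas.TrialState (n + 1) (Literature.MathematicalPhysics.QuantumManyBody.BoseGas.sideLength ρ (n + 1)), Literature.MathematicalPhysics.QuantumManyBody.BoseGas.energy v Ψ ≤ Literature.MathematicalPhysics.QuantumManyBody.BoseGas.groundStateEnergy v (n + 1) (Literature.MathematicalPhysics.QuantumManyBody.BoseGas.sideLength ρ (n + 1)) + δ → (∀ X, Ψ.ψ X = (‖Ψ.ψ X‖ : ℂ)) → ∫⁻ Y : Literature.MathematicalPhysics.QuantumManyBody.BoseGas.Config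 n, ENNReal.ofReal (∑ k : Fin 3 → Fin ⌈Literature.MathematicalPhysics.QuantumManyBody.BoseGas.sideLength ρ (n + 1) / l⌉₊, (∫ z, ‖Ψ.ψ (Matrix.vecCons z Y)‖ ^ 2) * (∫ Y' : Literature.MathematicalPhysics.QuantumManyBody.BoseGas.Config n, ∫ x in {y : EuclideanSpace ℝ (Fin 3) | ∀ j, y j ∈ Set.Ico (((k j : ℕ) : ℝ) * (Literature.MathematicalPhysics.QuantumManyBody.BoseGas.sideLength ρ (n + 1) / (⌈Literature.MathematicalPhysics.QuantumManyBody.BoseGas.sideLength ρ (n + 1) / l⌉₊ : ℝ))) ((((k j : ℕ) : ℝ) + 1) * (Literature.MathematicalPhysics.QuantumManyBody.BoseGas.sideLength ρ (n + 1) / (⌈Literature.MathematicalPhysics.QuantumManyBody.BoseGas.sideLength ρ (n + 1) / l⌉₊ : ℝ)))}, ‖Ψ.ψ (Matrix.vecCons x Y')‖ ^ 2) * InformationTheory.klFun ((∫ x in {y : EuclideanSpace ℝ (Fin 3) | ∀ j, y j ∈ Set.Ico (((k j : ℕ) : ℝ) * (Literature.MathematicalPhysics.QuantumManyBody.BoseGas.sideLength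 ρ (n + 1) / (⌈Literature.MathematicalPhysics.QuantumManyBody.BoseGas.sideLength ρ (n + 1) / l⌉₊ : ℝ))) ((((k j : ℕ) : ℝ) + 1) * (Literature.MathematicalPhysics.QuantumManyBody.BoseGas.sideLength ρ (n + 1) / (⌈Literature.MathematicalPhysics.QuantumManyBody.BoseGas.sideLength ρ (n + 1) / l⌉₊ : ℝ)))}, ‖Ψ.ψ (Matrix.vecCons x Y)‖ ^ 2) / ((∫ z, ‖Ψ.ψ (Matrix.vecCons z Y)‖ ^ 2) * (∫ Y' : Literature.MathematicalPhysics.QuantumManyBody.BoseGas.Config n, ∫ x in {y : EuclideanSpace ℝ (Fin 3) | ∀ j, y j ∈ Set.Ico (((k j : ℕ) : ℝ) * (Literature.MathematicalPhysics.QuantumManyBody.BoseGas.sideLength ρ (n + 1) / (⌈Literature.MathematicalPhysics.QuantumManyBody.BoseGas.sideLength ρ (n + 1) / l⌉₊ : ℝ))) ((((k j : ℕ) : ℝ) + 1) * (Literature.MathematicalPhysics.QuantumManyBody.BoseGas.sideLength ρ (n + 1) / (⌈Literature.MathematicalPhysics.QuantumManyBody.BoseGas.sideLength ρ (n + 1)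 / l⌉₊ : ℝ)))}, ‖Ψ.ψ (Matrix.vecCons x Y')‖ ^ 2)))) ≤ ENNReal.ofReal C

/-- item stmt-AtomisticToContinuum-13440 · crux · rank 3 · closed · proved by Summit.AtomisticToContinuum.BoseEinsteinCondensation.Theorems.oneBodyEntropyBound_proof @ 2486f39618aa (prover) · by planner
why it might fail: LY's cell bound is only LINEAR in n for overfull cells (superadditivity, LSSY (2.58)–(2.65): convexity of E₀(n,ℓ) unknown): at fixed ρ the overfull mass fraction is ≤ Cε(ρa³), not o(1), so mass f at diverging density (wall layer/clumps: KL ≥ (f/3)log N) is not excluded uniformly in N.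
sources: LSSY2005, LiebYngvason1998, arXiv:1904.06164, FournaisSolovej2020, Ledoux2001, BakryGentilLedoux2014
[crux] ONE-BODY PROFILE ENTROPY BOUND (cell-free replacement of gen-0's ProfileEntropyBound
ex-stmt-3595; no positivity hypothesis): for every repulsive finite-range v there is ρ₀ > 0 such
that for 0 < ρ < ρ₀ there is C with: for all large N = n+1 there is δ > 0 such that every
δ-near-minimiser Ψ (complex allowed) has KL(P¹ ‖ u_Λ) ≤ C, P¹(x) = ∫|Ψ(x,Y)|²dY the one-body law;
typed ∫_(x∈Λ) L⁻³·klFun(L³P¹(x)) dx ≤ C (= KL since ∫_Λ P¹ = 1). Expected proof (the foreseen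
split): coarse part KL(P_l‖ū_l) ≤ log(1+χ²) = O(1) by the Lieb–Yngvason cell method applied to the
STATE's occupation law (energy(Ψ) ≥ E_Ψ Σ_cells E₀^Neu(n_c,l); tree: LSSY2005_boxLowerBound_holds,
LSSY2005_cellDecomposition) against energy ≤ KN+δ (eventually_groundStateEnergy_le_dyson):
M³Σ_kP_l(k)² = O(1) at fixed ρ for l ≳ max(ρ^(−1/3), aY^(−6/17)); fine part Σ_k P_l(k)KL(P¹_k‖u_k) ≤
c₀(L/M)²∫|∇√P¹|² ≤ c₀l²(K + δ/N) by the cube LSI and convexity of Fisher information under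
Y-averaging. Free Dirichlet gas: KL(P¹‖u) = 3(1 − log 2) ≈ 0.92. [difficulty: M] -/
@[route_item "route-AtomisticToContinuum-BECCellInformation", crux]
def OneBodyEntropyBound : Prop :=
  ∀ v : ℝ → ENNReal, Literature.MathematicalPhysics.QuantumManyBody.BoseGas.IsRepulsiveFiniteRange v → ∃ ρ₀ : ℝ, 0 < ρ₀ ∧ ∀ ρ : ℝ, 0 < ρ → ρ < ρ₀ → ∃ C : ℝ, ∀ᶠ n : ℕ in Filter.atTop, ∃ δ : ENNReal, 0 < δ ∧ ∀ Ψ : Literature.MathematicalPhysics.QuantumManyBody.BoseGas.TrialState (n + 1) (Literature.MathematicalPhysics.QuantumManyBody.BoseGas.sideLength ρ (n + 1)), Literature.MathematicalPhysics.QuantumManyBody.BoseGas.energy v Ψ ≤ Literature.MathematicalPhysics.QuantumManyBody.BoseGas.groundStateEnergy v (n + 1) (Literature.MathematicalPhysics.QuantumManyBody.BoseGas.sideLength ρ (n + 1)) + δ → ∫⁻ x in Literature.MathematicalPhysics.QuantumManyBody.BoseGas.box (Literature.MathematicalPhysics.QuantumManyBody.BoseGas.sideLength ρ (n + 1)), ENNReal.ofReal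 ((Literature.MathematicalPhysics.QuantumManyBody.BoseGas.sideLength ρ (n + 1) ^ 3)⁻¹ * InformationTheory.klFun (Literature.MathematicalPhysics.QuantumManyBody.BoseGas.sideLength ρ (n + 1) ^ 3 * (∫ Y' : Literature.MathematicalPhysics.QuantumManyBody.BoseGas.Config n, ‖Ψ.ψ (Matrix.vecCons x Y')‖ ^ 2))) ≤ ENNReal.ofReal C

/-- item stmt-AtomisticToContinuum-9072 · crux · rank 4 · open · by planner
why it might fail: ⊤-valued v are admissible (hard cores, hollow shells ⊤·1_[R₁,R₂]): the finite-energy configuration set disconnects and |Ψ|-uniqueness (LSSY Ch. 2) works per component only; unless the dilute component is the unique minimiser for all large N (open), the ground space degenerates: no δ pins the phase.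
sources: ReedSimonIV1978, Simon1982, LSSY2005, Kahle2012, BaryshnikovBubenikKahle2013, stmt-AtomisticToContinuum-9072
[crux] (shared verbatim with BECPalmLandscape stmt-AtomisticToContinuum-3298; the uniqueness input
of the descent) for every repulsive finite-range v there is ρ₀ > 0 such that for 0 < ρ < ρ₀ and all
large N, for every η > 0 there is δ > 0 with: any two δ-near-minimisers Ψ, Φ of the Dirichlet energy
in the box of side (N/ρ)^{1/3} satisfy ∫|Ψ − cΦ|² ≤ η for some unit complex c (E₀ < ∞, compact
resolvent, unique positive ground state and spectral gap at fixed N). [difficulty: M] -/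
@[route_item "route-AtomisticToContinuum-BECCellInformation", crux]
def GroundStateRigidity : Prop :=
  ∀ v : ℝ → ENNReal, Literature.MathematicalPhysics.QuantumManyBody.BoseGas.IsRepulsiveFiniteRange v → ∃ ρ₀ : ℝ, 0 < ρ₀ ∧ ∀ ρ : ℝ, 0 < ρ → ρ < ρ₀ → ∀ᶠ N : ℕ in Filter.atTop, ∀ η : ℝ, 0 < η → ∃ δ : ENNReal, 0 < δ ∧ ∀ Ψ Φ : Literature.MathematicalPhysics.QuantumManyBody.BoseGas.TrialState N (Literature.MathematicalPhysics.QuantumManyBody.BoseGas.sideLength ρ N), Literature.MathematicalPhysics.QuantumManyBody.BoseGas.energy v Ψ ≤ Literature.MathematicalPhysics.QuantumManyBody.BoseGas.groundStateEnergy v N (Literature.MathematicalPhysics.QuantumManyBody.BoseGas.sideLength ρ N) + δ → Literature.MathematicalPhysics.QuantumManyBody.BoseGas.energy v Φ ≤ Literature.MathematicalPhysics.QuantumManyBody.BoseGas.groundStateEnergy v N (Literature.MathematicalPhysics.QuantumManyBody.BoseGas.sideLength ρ N) + δ → ∃ c : ℂ, ‖c‖ = 1 ∧ ∫⁻ X,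 (‖Ψ.ψ X - c * Φ.ψ X‖₊ : ENNReal) ^ 2 ≤ ENNReal.ofReal η

/-- item stmt-AtomisticToContinuum-13441 · support · rank 9 · closed · proved by Summit.AtomisticToContinuum.BoseEinsteinCondensation.Theorems.coarseChainRule_proof (prover) · by planner
sources: CoverThomas2005, GrunewaldEtAl2009, Csiszar1975
[support] CellInformationBound → OneBodyEntropyBound → COARSE CONDITIONAL ENTROPY BOUND at the scale
l of crux 2: E_Y KL(Q_l(·|Y) ‖ ū_l) ≤ C′, Q_l(k|Y) = A_k(Y)/m(Y) = P(x₁ ∈ cell k | Y), typed ∫_Y Σ_k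
m(Y)M⁻³klFun(M³A_k(Y)/m(Y)) dY ≤ C′ (gen-0's coarse form). Proof: pointwise in Y, Σ_k
mM⁻³klFun(M³A_k/m) = Σ_k A_k log(M³A_k/m) (Σ_kA_k = m: cells tile [0,L)³ ⊇ Λ, Ψ = 0 off Λ) = [Σ_k
A_k log(A_k/(mP_l(k)))] + [Σ_k A_k log(M³P_l(k))]; the first bracket is crux 2's integrand; ∫dY of
the positive part of the second is ≤ KL(P_l‖ū_l) + e⁻¹ ≤ KL(P¹‖u_Λ) + e⁻¹ ≤ C_B + 1 (log-sum
inequality per cell); C′ = C_A + C_B + 1, l := l_A, δ := min, ρ₀ := min. Lean effort M (Fubini over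
Config n × cells, finite sums, klFun junk values at 0). [deps: CellInformationBound,
OneBodyEntropyBound] [difficulty: provable-now] -/
@[route_item "route-AtomisticToContinuum-BECCellInformation", crux]
def CoarseChainRule : Prop :=
  CellInformationBound → OneBodyEntropyBound → (∀ v : ℝ → ENNReal, Literature.MathematicalPhysics.QuantumManyBody.BoseGas.IsRepulsiveFiniteRange v → ∃ ρ₀ : ℝ, 0 < ρ₀ ∧ ∀ ρ : ℝ, 0 < ρ → ρ < ρ₀ → ∃ l : ℝ, 0 < l ∧ ∃ C : ℝ, ∀ᶠ n : ℕ in Filter.atTop, ∃ δ : ENNReal, 0 < δ ∧ ∀ Ψ : Literature.MathematicalPhysics.QuantumManyBody.BoseGas.TrialState (n + 1) (Literature.MathematicalPhysics.QuantumManyBody.BoseGas.sideLength ρ (n + 1)), Literature.MathematicalPhysics.QuantumManyBody.BoseGas.energy v Ψ ≤ Literature.MathematicalPhysics.QuantumManyBody.BoseGas.groundStateEnergy v (n + 1) (Literature.MathematicalPhysics.QuantumManyBody.BoseGas.sideLength ρ (n + 1)) + δ → (∀ X, Ψ.ψ X = (‖Ψ.ψ X‖ : ℂ)) → ∫⁻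 Y : Literature.MathematicalPhysics.QuantumManyBody.BoseGas.Config n, ENNReal.ofReal (∑ k : Fin 3 → Fin ⌈Literature.MathematicalPhysics.QuantumManyBody.BoseGas.sideLength ρ (n + 1) / l⌉₊, (∫ z, ‖Ψ.ψ (Matrix.vecCons z Y)‖ ^ 2) / (⌈Literature.MathematicalPhysics.QuantumManyBody.BoseGas.sideLength ρ (n + 1) / l⌉₊ : ℝ) ^ 3 * InformationTheory.klFun ((⌈Literature.MathematicalPhysics.QuantumManyBody.BoseGas.sideLength ρ (n + 1) / l⌉₊ : ℝ) ^ 3 * (∫ x in {y : EuclideanSpace ℝ (Fin 3) | ∀ j, y j ∈ Set.Ico (((k j : ℕ) : ℝ) * (Literature.MathematicalPhysics.QuantumManyBody.BoseGas.sideLength ρ (n + 1) / (⌈Literature.MathematicalPhysics.QuantumManyBody.BoseGas.sideLength ρ (n + 1) / l⌉₊ : ℝ))) ((((k j : ℕ) : ℝ) + 1) * (Literature.MathematicalPhysics.QuantumManyBody.BoseGas.sideLength ρ (n + 1) / (⌈Literature.MathematicalPhysics.QuantumManyBody.BoseGas.sideLength ρ (n + 1) / l⌉₊ : ℝ)))},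 ‖Ψ.ψ (Matrix.vecCons x Y)‖ ^ 2) / (∫ z, ‖Ψ.ψ (Matrix.vecCons z Y)‖ ^ 2))) ≤ ENNReal.ofReal C)

/-- item stmt-AtomisticToContinuum-13442 · support · rank 9 · closed · proved by Summit.AtomisticToContinuum.BoseEinsteinCondensation.Theorems.energyPerParticleBound_proof (prover) · by planner
sources: LSSY2005, Dyson1957, Literature.MathematicalPhysics.QuantumManyBody.BoseGas.eventually_groundStateEnergy_le_dyson
[support] ENERGY PER PARTICLE BOUNDED at small density (verbatim gen-0 ex-stmt-3600): for every
repulsive finite-range v there is ρ₀ > 0 such that for 0 < ρ < ρ₀ there is K with E₀(N,(N/ρ)^(1/3))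
≤ K·N for all large N. Now one line from the tree:
Literature…BoseGas.eventually_groundStateEnergy_le_dyson (PROVED: E₀ ≤ 4πρa(1+C(ρa³)^(1/3))N
eventually, for 0 < a < ∞) and, for scattering length 0 or in general,
groundStateEnergy_le_of_separated_cubes / the symmetrised disjoint-bump state (interaction 0, ⊤·0 =
0). Only boundedness is used (TwoScaleReduction's local term, ZeroModeTransfer's E₀ < ⊤).
[difficulty: provable-now] -/
@[route_item "route-AtomisticToContinuum-BECCellInformation", crux]
def EnergyPerParticleBound : Prop :=
  ∀ v : ℝ → ENNReal, Literature.MathematicalPhysics.QuantumManyBody.BoseGas.IsRepulsiveFiniteRange v → ∃ ρ₀ : ℝ, 0 < ρ₀ ∧ ∀ ρ : ℝ, 0 < ρ → ρ < ρ₀ → ∃ K : ℝ, ∀ᶠ N : ℕ in Filter.atTop, Literature.MathematicalPhysics.QuantumManyBody.BoseGas.groundStateEnergy v N (Literature.MathematicalPhysics.QuantumManyBody.BoseGas.sideLength ρ N) ≤ ENNReal.ofReal (K * N)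

/-- item stmt-AtomisticToContinuum-13443 · support · rank 9 · closed · proved by Summit.AtomisticToContinuum.BoseEinsteinCondensation.Theorems.TwoScaleReduction.twoScaleReduction_proof @ 29d46192d11a (prover) · by planner
sources: Weissler1980, Ledoux2001, BakryGentilLedoux2014, GrunewaldEtAl2009, OttoVillani2000, LSSY2005
[support] EnergyPerParticleBound → (coarse conditional entropy bound at some scale l, the conclusion
of CoarseChainRule) → CondEntropyBound. Exact KL chain rule over the cell partition for each Y:
KL(p(·|Y)‖u_Λ) = KL(Q_l(·|Y)‖ū_l) + Σ_k Q_l(k|Y)·KL(p_k(·|Y)‖u_k); the local term is Σ_k Q_k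
Ent_(u_k)(f_k) ≤ c₀(L/M)²∫_Λ|∇_x√p(x|Y)|²dx by the logarithmic Sobolev inequality for Lebesgue
measure on a cube of side s = L/M ≤ l (constant c₀s²: Weissler1980 circle LSI + even reflection +
tensorisation), with √p = |Ψ(·,Y)|/√m(Y), ∫|∇√p|² ≤ ∫|∇_xΨ(x,Y)|²dx/m(Y); its m(Y)dY-average is
c₀s²·T(Ψ)/N (Bose symmetry) ≤ c₀l²(K + δ/N) as T ≤ energy ≤ KN + δ; choose δ := min(δ_coarse, 1), C
:= C′ + c₀l²(max K 0 + 1); shift the atTop filter N = n+1. A theorem on paper; L in Lean (cube LSI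
not in Mathlib; one helper shared with crux 3's split). [deps: EnergyPerParticleBound,
CoarseChainRule] [difficulty: L] -/
@[route_item "route-AtomisticToContinuum-BECCellInformation", crux]
def TwoScaleReduction : Prop :=
  (∀ v : ℝ → ENNReal, Literature.MathematicalPhysics.QuantumManyBody.BoseGas.IsRepulsiveFiniteRange v → ∃ ρ₀ : ℝ, 0 < ρ₀ ∧ ∀ ρ : ℝ, 0 < ρ → ρ < ρ₀ → ∃ K : ℝ, ∀ᶠ N : ℕ in Filter.atTop, Literature.MathematicalPhysics.QuantumManyBody.BoseGas.groundStateEnergy v N (Literature.MathematicalPhysics.QuantumManyBody.BoseGas.sideLength ρ N) ≤ ENNReal.ofReal (K * N)) → (∀ v : ℝ → ENNReal, Literature.MathematicalPhysics.QuantumManyBody.BoseGas.IsRepulsiveFiniteRange v → ∃ ρ₀ : ℝ, 0 < ρ₀ ∧ ∀ ρ : ℝ, 0 < ρ → ρ < ρ₀ → ∃ l : ℝ, 0 < l ∧ ∃ C : ℝ, ∀ᶠ n : ℕ in Filter.atTop, ∃ δ : ENNReal, 0 < δ ∧ ∀ Ψ : Literature.MathematicalPhysics.QuantumManyBody.BoseGas.TrialState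 (n + 1) (Literature.MathematicalPhysics.QuantumManyBody.BoseGas.sideLength ρ (n + 1)), Literature.MathematicalPhysics.QuantumManyBody.BoseGas.energy v Ψ ≤ Literature.MathematicalPhysics.QuantumManyBody.BoseGas.groundStateEnergy v (n + 1) (Literature.MathematicalPhysics.QuantumManyBody.BoseGas.sideLength ρ (n + 1)) + δ → (∀ X, Ψ.ψ X = (‖Ψ.ψ X‖ : ℂ)) → ∫⁻ Y : Literature.MathematicalPhysics.QuantumManyBody.BoseGas.Config n, ENNReal.ofReal (∑ k : Fin 3 → Fin ⌈Literature.MathematicalPhysics.QuantumManyBody.BoseGas.sideLength ρ (n + 1) / l⌉₊, (∫ z, ‖Ψ.ψ (Matrix.vecCons z Y)‖ ^ 2) / (⌈Literature.MathematicalPhysics.QuantumManyBody.BoseGas.sideLength ρ (n + 1) / l⌉₊ : ℝ) ^ 3 * InformationTheory.klFun ((⌈Literature.MathematicalPhysics.QuantumManyBody.BoseGas.sideLength ρ (n + 1) / l⌉₊ : ℝ) ^ 3 * (∫ x in {y : EuclideanSpace ℝ (Fin 3) | ∀ j, y j ∈ Set.Ico (((k j : ℕ) : ℝ) * (Literature.MathematicalPhysics.QuantumManyBody.BoseGas.sideLength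 ρ (n + 1) / (⌈Literature.MathematicalPhysics.QuantumManyBody.BoseGas.sideLength ρ (n + 1) / l⌉₊ : ℝ))) ((((k j : ℕ) : ℝ) + 1) * (Literature.MathematicalPhysics.QuantumManyBody.BoseGas.sideLength ρ (n + 1) / (⌈Literature.MathematicalPhysics.QuantumManyBody.BoseGas.sideLength ρ (n + 1) / l⌉₊ : ℝ)))}, ‖Ψ.ψ (Matrix.vecCons x Y)‖ ^ 2) / (∫ z, ‖Ψ.ψ (Matrix.vecCons z Y)‖ ^ 2))) ≤ ENNReal.ofReal C) → CondEntropyBound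

/-- item stmt-AtomisticToContinuum-13444 · support · rank 9 · closed · proved by Summit.AtomisticToContinuum.BoseEinsteinCondensation.Theorems.entropicZeroMode_proof (prover) · by planner
sources: Reatto1969, PenroseOnsager1956, LSSY2005, CoverThomas2005
[support] CondEntropyBound → ZERO-MODE OCCUPATION ≥ cN FOR NON-NEGATIVE NEAR-MINIMISERS (∀v ∃ρ₀
∀ρ<ρ₀ ∃c>0 ∀ᶠN ∃δ>0 ∀Ψ δ-near-min, Ψ ≥ 0 → ofReal(cN) ≤ occupation N φ₀ Ψ, φ₀ = L^(−3/2)·1_Λ; the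
conclusion is X_B1's body with the positivity hypothesis added). Rényi-½ identity: for Ψ ≥ 0,
occupation N φ₀ Ψ / N = L⁻³∫(∫Ψ(x,Y)dx)²dY = E_(m dY) exp(−D_½(p(·|Y)‖u_Λ)); Jensen for exp(−·)
under the probability law m(Y)dY and D_½ = −2log∫√(pu) ≤ KL (concavity of log) give occupation ≥
exp(−max(C,0))·N (c absorbs C < 0: lesson of BECSwapAffinitySwapJensen_refuted); index shift N =
n+1. Lean effort M (Jensen for lintegral/exp; occupation unfolds by rfl on n+1). [deps:
CondEntropyBound] [difficulty: provable-now] -/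
@[route_item "route-AtomisticToContinuum-BECCellInformation", crux]
def EntropicZeroMode : Prop :=
  CondEntropyBound → (∀ v : ℝ → ENNReal, Literature.MathematicalPhysics.QuantumManyBody.BoseGas.IsRepulsiveFiniteRange v → ∃ ρ₀ : ℝ, 0 < ρ₀ ∧ ∀ ρ : ℝ, 0 < ρ → ρ < ρ₀ → ∃ c : ℝ, 0 < c ∧ ∀ᶠ N : ℕ in Filter.atTop, ∃ δ : ENNReal, 0 < δ ∧ ∀ Ψ : Literature.MathematicalPhysics.QuantumManyBody.BoseGas.TrialState N (Literature.MathematicalPhysics.QuantumManyBody.BoseGas.sideLength ρ N), Literature.MathematicalPhysics.QuantumManyBody.BoseGas.energy v Ψ ≤ Literature.MathematicalPhysics.QuantumManyBody.BoseGas.groundStateEnergy v N (Literature.MathematicalPhysics.QuantumManyBody.BoseGas.sideLength ρ N) + δ → (∀ X, Ψ.ψ X = (‖Ψ.ψ X‖ : ℂ)) → ENNReal.ofReal (c * N) ≤ Literature.MathematicalPhysics.QuantumManyBody.BoseGas.occupation N ((Literature.MathematicalPhysics.QuantumManyBody.BoseGas.box (Literature.MathematicalPhysics.QuantumManyBody.BoseGas.sideLength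 ρ N)).indicator fun _ => ((Real.sqrt (Literature.MathematicalPhysics.QuantumManyBody.BoseGas.sideLength ρ N ^ 3))⁻¹ : ℂ)) Ψ.ψ)

/-- item stmt-AtomisticToContinuum-13445 · support · rank 9 · closed · proved by Summit.AtomisticToContinuum.BoseEinsteinCondensation.Theorems.nonnegNearMinimiser_proof (prover) · by planner
sources: ReedSimonIV1978, LiebLoss2001, LSSY2005
[support] NON-NEGATIVE NEAR-MINIMISERS EXIST (diamagnetic smoothing; new, frame lemma usable by
every positivity route): for all v, N, L with E₀(N,L) ≠ ⊤ and every δ > 0 there is a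
δ-near-minimiser Ψ ∈ TrialState N L with Ψ = |Ψ| pointwise. Proof: Φ with energy ≤ E₀ + δ/2; f_ε :=
√(|Φ|²+ε²) − ε is C¹, vanishes exactly where Φ does (off Λ^N; a.e. on hard cores), symmetric, 0 ≤
f_ε ≤ |Φ|, |∇f_ε| = |Re(Φ̄∇Φ)|/√(|Φ|²+ε²) ≤ |∇Φ|; so energy(f_ε/‖f_ε‖₂) ≤ energy(Φ)/‖f_ε‖₂² and
‖f_ε‖₂ ↑ 1 as ε ↓ 0, giving energy ≤ E₀ + δ for ε small. Degenerate regimes checked: N = 0 (Config 0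
is a point, Ψ ≡ 1), L ≤ 0 < N (TrialState empty ⇒ E₀ = ⊤, hypothesis false), δ = ⊤ trivial. Lean
effort M (smoothed TrialState; ContDiff of sqrt off 0; monotone convergence). [difficulty:
provable-now] -/
@[route_item "route-AtomisticToContinuum-BECCellInformation", crux]
def NonnegNearMinimiser : Prop :=
  ∀ (v : ℝ → ENNReal) (N : ℕ) (L : ℝ), Literature.MathematicalPhysics.QuantumManyBody.BoseGas.groundStateEnergy v N L ≠ ⊤ → ∀ δ : ENNReal, 0 < δ → ∃ Ψ : Literature.MathematicalPhysics.QuantumManyBody.BoseGas.TrialState N L, Literature.MathematicalPhysics.QuantumManyBody.BoseGas.energy v Ψ ≤ Literature.MathematicalPhysics.QuantumManyBody.BoseGas.groundStateEnergy v N L + δ ∧ ∀ X, Ψ.ψ X = (‖Ψ.ψ X‖ : ℂ)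

/-- item stmt-AtomisticToContinuum-13446 · support · rank 9 · closed · proved by Summit.AtomisticToContinuum.BoseEinsteinCondensation.Theorems.zeroModeTransfer_proof @ 5650e60faa7f (prover) · by planner
sources: LSSY2005, PenroseOnsager1956, Summits.AtomisticToContinuum.BoseEinsteinCondensation.Theorems.BECInfraredBoundAssembly
[support] GLUE TO THE PROVED FRAME (bookkeeping): EnergyPerParticleBound → NonnegNearMinimiser →
GroundStateRigidity → OccupationStability → (zero-mode bound for non-negative near-minimisers,
EntropicZeroMode's conclusion) → X_B1, where X_B1 is VERBATIM the hypothesis of the proved theorem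
AtomisticToContinuum.BECInfraredBound.bec_of_zeroMode (= BECInfraredBound's zero-mode thesis
ex-stmt-0686: ∀v ∃ρ₀ ∀ρ<ρ₀ ∃c>0 ∀ᶠN ∃δ>0 ∀ δ-near-minimisers Ψ: ofReal(cN) ≤ occupation N φ₀ Ψ).
Proof: ρ₀ := min; c′ := c/4; eventually in N: δ₁ (zero-mode hyp.), δ₂ (rigidity at η := c/4), δ :=
min δ₁ δ₂; E₀ ≤ KN < ⊤ so NonnegNearMinimiser gives a non-negative δ-near-minimiser Ψ with occ(φ₀,Ψ)
≥ cN; for any δ-near-minimiser Φ rigidity gives ‖Ψ − c̃Φ‖₂² ≤ c/4 and OccupationStability (u = φ₀,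
measurable + normalised for L > 0: tree lemmas aestronglyMeasurable_constMode,
lintegral_constMode_sq) gives occ(φ₀,Φ)^(1/2) ≥ (cN)^(1/2) − (Nc/4)^(1/2) = ½(cN)^(1/2), i.e. occ ≥
cN/4. Lean effort M (ENNReal rpow ½ arithmetic, filter bookkeeping). [deps: EnergyPerParticleBound,
NonnegNearMinimiser, GroundStateRigidity, OccupationStability, EntropicZeroMode] [difficulty:
provable-now] -/
@[route_item "route-AtomisticToContinuum-BECCellInformation", crux]
def ZeroModeTransfer : Prop :=
  (∀ v : ℝ → ENNReal, Literature.MathematicalPhysics.QuantumManyBody.BoseGas.IsRepulsiveFiniteRange v → ∃ ρ₀ : ℝ, 0 < ρ₀ ∧ ∀ ρ : ℝ, 0 < ρ → ρ < ρ₀ → ∃ K : ℝ, ∀ᶠ N : ℕ in Filter.atTop, Literature.MathematicalPhysics.QuantumManyBody.BoseGas.groundStateEnergy v N (Literature.MathematicalPhysics.QuantumManyBody.BoseGas.sideLength ρ N) ≤ ENNReal.ofReal (K * N)) → (∀ (v : ℝ → ENNReal) (N : ℕ) (L : ℝ), Literature.MathematicalPhysics.QuantumManyBody.BoseGas.groundStateEnergy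 v N L ≠ ⊤ → ∀ δ : ENNReal, 0 < δ → ∃ Ψ : Literature.MathematicalPhysics.QuantumManyBody.BoseGas.TrialState N L, Literature.MathematicalPhysics.QuantumManyBody.BoseGas.energy v Ψ ≤ Literature.MathematicalPhysics.QuantumManyBody.BoseGas.groundStateEnergy v N L + δ ∧ ∀ X, Ψ.ψ X = (‖Ψ.ψ X‖ : ℂ)) → GroundStateRigidity → (∀ (n : ℕ) (L : ℝ) (u : Literature.MathematicalPhysics.QuantumManyBody.BoseGas.Space → ℂ), MeasureTheory.AEStronglyMeasurable u MeasureTheory.volume → ∫⁻ x, (‖u x‖₊ : ENNReal) ^ 2 = 1 → ∀ (Ψ Φ : Literature.MathematicalPhysics.QuantumManyBody.BoseGas.TrialState (n + 1) L) (c : ℂ), ‖c‖ = 1 → Literature.MathematicalPhysics.QuantumManyBody.BoseGas.occupation (n + 1) u Ψ.ψ ^ (1 / 2 : ℝ) ≤ Literature.MathematicalPhysics.QuantumManyBody.BoseGas.occupation (n + 1) u Φ.ψ ^ (1 / 2 : ℝ) + ((n + 1 : ℕ) : ENNReal) ^ (1 / 2 : ℝ) * (∫⁻ X, (‖Ψ.ψ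 X - c * Φ.ψ X‖₊ : ENNReal) ^ 2) ^ (1 / 2 : ℝ)) → (∀ v : ℝ → ENNReal, Literature.MathematicalPhysics.QuantumManyBody.BoseGas.IsRepulsiveFiniteRange v → ∃ ρ₀ : ℝ, 0 < ρ₀ ∧ ∀ ρ : ℝ, 0 < ρ → ρ < ρ₀ → ∃ c : ℝ, 0 < c ∧ ∀ᶠ N : ℕ in Filter.atTop, ∃ δ : ENNReal, 0 < δ ∧ ∀ Ψ : Literature.MathematicalPhysics.QuantumManyBody.BoseGas.TrialState N (Literature.MathematicalPhysics.QuantumManyBody.BoseGas.sideLength ρ N), Literature.MathematicalPhysics.QuantumManyBody.BoseGas.energy v Ψ ≤ Literature.MathematicalPhysics.QuantumManyBody.BoseGas.groundStateEnergy v N (Literature.MathematicalPhysics.QuantumManyBody.BoseGas.sideLength ρ N) + δ → (∀ X, Ψ.ψ X = (‖Ψ.ψ X‖ : ℂ)) → ENNReal.ofReal (c * N) ≤ Literature.MathematicalPhysics.QuantumManyBody.BoseGas.occupation N ((Literature.MathematicalPhysics.QuantumManyBody.BoseGas.box (Literature.MathematicalPhysics.QuantumManyBody.BoseGas.sideLength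 ρ N)).indicator fun _ => ((Real.sqrt (Literature.MathematicalPhysics.QuantumManyBody.BoseGas.sideLength ρ N ^ 3))⁻¹ : ℂ)) Ψ.ψ) → (∀ v : ℝ → ENNReal, Literature.MathematicalPhysics.QuantumManyBody.BoseGas.IsRepulsiveFiniteRange v → ∃ ρ₀ : ℝ, 0 < ρ₀ ∧ ∀ ρ : ℝ, 0 < ρ → ρ < ρ₀ → ∃ c : ℝ, 0 < c ∧ ∀ᶠ N : ℕ in Filter.atTop, ∃ δ : ENNReal, 0 < δ ∧ ∀ Ψ : Literature.MathematicalPhysics.QuantumManyBody.BoseGas.TrialState N (Literature.MathematicalPhysics.QuantumManyBody.BoseGas.sideLength ρ N), Literature.MathematicalPhysics.QuantumManyBody.BoseGas.energy v Ψ ≤ Literature.MathematicalPhysics.QuantumManyBody.BoseGas.groundStateEnergy v N (Literature.MathematicalPhysics.QuantumManyBody.BoseGas.sideLength ρ N) + δ → ENNReal.ofReal (c * N) ≤ Literature.MathematicalPhysics.QuantumManyBody.BoseGas.occupation N ((Literature.MathematicalPhysics.QuantumManyBody.BoseGas.box (Literature.MathematicalPhysics.QuantumManyBody.BoseGas.sideLength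 ρ N)).indicator fun _ => ((Real.sqrt (Literature.MathematicalPhysics.QuantumManyBody.BoseGas.sideLength ρ N ^ 3))⁻¹ : ℂ)) Ψ.ψ)

/-- item stmt-AtomisticToContinuum-9074 · support · rank 9 · closed · proved by Summit.AtomisticToContinuum.BoseEinsteinCondensation.Theorems.occupationStability_proof @ 4a4e6659c153 (prover) · by planner
sources: LSSY2005, stmt-AtomisticToContinuum-9074
[support] (shared verbatim with BECPalmLandscape stmt-AtomisticToContinuum-3300) for a normalised
measurable mode u, trial states Ψ, Φ ∈ TrialState (n+1) L and |c| = 1: occ(u,Ψ)^{1/2} ≤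
occ(u,Φ)^{1/2} + (n+1)^{1/2}·‖Ψ − cΦ‖₂ (Minkowski in L²(dY); occ(cΦ) = occ(Φ)). [difficulty:
provable-now] -/
@[route_item "route-AtomisticToContinuum-BECCellInformation", crux]
def OccupationStability : Prop :=
  ∀ (n : ℕ) (L : ℝ) (u : Literature.MathematicalPhysics.QuantumManyBody.BoseGas.Space → ℂ), MeasureTheory.AEStronglyMeasurable u MeasureTheory.volume → ∫⁻ x, (‖u x‖₊ : ENNReal) ^ 2 = 1 → ∀ (Ψ Φ : Literature.MathematicalPhysics.QuantumManyBody.BoseGas.TrialState (n + 1) L) (c : ℂ), ‖c‖ = 1 → Literature.MathematicalPhysics.QuantumManyBody.BoseGas.occupation (n + 1) u Ψ.ψ ^ (1 / 2 : ℝ) ≤ Literature.MathematicalPhysics.QuantumManyBody.BoseGas.occupation (n + 1) u Φ.ψ ^ (1 / 2 : ℝ) + ((n + 1 : ℕ) : ENNReal) ^ (1 / 2 : ℝ) * (∫⁻ X, (‖Ψ.ψ X - c * Φ.ψ X‖₊ : ENNReal) ^ 2) ^ (1 / 2 : ℝ)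

/-- `OccupationStability` holds: proved by `Summit.AtomisticToContinuum.BoseEinsteinCondensation.Theorems.occupationStability_proof` @ 4a4e6659c153. -/
theorem OccupationStability_holds : OccupationStability := _root_.Summit.AtomisticToContinuum.BoseEinsteinCondensation.Theorems.occupationStability_proof

/-- item stmt-AtomisticToContinuum-13447 · assembly · rank 1 · closed · proved by Summit.AtomisticToContinuum.BoseEinsteinCondensation.Theorems.becCellInformation_assembly_proof @ 2b7c8b0311b0 (prover) · by planner
sources: LSSY2005, PenroseOnsager1956
[assembly] CellInformationBound → OneBodyEntropyBound → GroundStateRigidity → CoarseChainRule →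
EnergyPerParticleBound → TwoScaleReduction → EntropicZeroMode → NonnegNearMinimiser →
OccupationStability → ZeroModeTransfer → BoseEinsteinCondensation (the sub-problem decl, _root_). -/
@[route_item "route-AtomisticToContinuum-BECCellInformation"]
def Assembly : Prop :=
  CellInformationBound → OneBodyEntropyBound → GroundStateRigidity → CoarseChainRule → EnergyPerParticleBound → TwoScaleReduction → EntropicZeroMode → NonnegNearMinimiser → OccupationStability → ZeroModeTransfer → _root_.BoseEinsteinCondensation

/-! D-0027 §2.1 — DECIDING THEOREM (planner-authored via `route open/edit --closes-file`; by planner-plancard-AtomisticToContinuum-BoseEin-7481a7ec-g2-0 2026-08-15T19:01:44Z):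
its hypotheses are this route's items and its conclusion the sub-problem Statement (glue_lint), and it elaborates with this file. -/

@[closes "route-AtomisticToContinuum-BECCellInformation"] theorem closes (hA : CellInformationBound) (hB : OneBodyEntropyBound) (hR : GroundStateRigidity) (hCR : CoarseChainRule) (hE : EnergyPerParticleBound) (hT : TwoScaleReduction) (hJ : EntropicZeroMode) (hNN : NonnegNearMinimiser) (hO : OccupationStability) (hZ : ZeroModeTransfer) : _root_.BoseEinsteinCondensation :=
  AtomisticToContinuum.BECInfraredBound.bec_of_zeroMode (hZ hE hNN hR hO (hJ (hT hE (hCR hA hB))))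

end Summit.AtomisticToContinuum.BoseEinsteinCondensation.Theses.BECCellInformation
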